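import Literature.MathematicalPhysics.QuantumLattice.QuantumSpinBlockChessboardEstimate
import HarnessLib

/-!
# Choosing the partition: every contour has a shifted cube partition in which a fixed fraction of
# its bonds are interior to distinct cubes (Fröhlich–Lieb 1978, §I.D, eq. (1.43))

Topic `MathematicalPhysics/QuantumLattice`; the combinatorial half of Fröhlich–Lieb's use of the
chessboard estimate with many-site basic elements. FL (1.43): "`γ` can be written as a union of
disjoint subsets `γ₁, …` such that the bonds of each `γ_α` belong to DISTINCT elements of ONE
partition; hence for some `α`, `|γ_α| ≥ |γ|/(number of partitions)`". On the torus `(ℤ/Nbℤ)^d` cut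
into cubes of side `b` (`QuantumSpinBlockChessboardEstimate`: `blockSite`, `blockOf`, `offsetOf`)
the partitions are the `b^d` translates `v + cubes`; we average over ALL shifts `v ∈ (ℤ/Nbℤ)^d`:

* `blockSite_update_succ`, `blockOf_add_single_of_lt` — a unit step inside a cube does not leave it;
* `card_filter_apply_eq_mul`, `card_filter_offsetOf_eq_mul` — the offsets are equidistributed:
  `b · #{u : offsetOf u k = a} = |Λ|`;
* `card_filter_sameBlock_ge` — a nearest-neighbour bond `{i, i + e_k}` is interior to a cube of the
  partition shifted by `v` for at least the fraction `(b-1)/b` of the shifts `v`;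
* **`exists_shift_many_interior`** — for every finite set of nearest-neighbour bonds there is a
  shift `v` with `(b-1)·#bonds ≤ b·#{bonds interior for v}` (averaging / pigeonhole);
* **`exists_shift_cube_selection`** — FL (1.43): a shift `v`, a set `D` of cubes and one interior
  bond `sel c` in each cube `c ∈ D`, with `(b-1)·#bonds ≤ b^{2d+1}·|D|` (each cube holds at most
  `b^{2d}` ordered bonds).

Pure finite combinatorics; no named facts, no sorries. Used by the Peierls–chessboard bound
(`PeierlsChessboardBound`) to turn `κ^{|D_C|}` into `κ^{c·|∂C|}`.

## References

* J. Fröhlich, E. H. Lieb, *Phase transitions in anisotropic lattice spin systems*, Comm. Math.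
  Phys. **60** (1978) 233–267, §I.D, eqs. (1.41)–(1.44). [FrohlichLieb1978]
* S. Friedli, Y. Velenik, *Statistical Mechanics of Lattice Systems* (2017), §10.2 (block
  partitions of the torus). [FriedliVelenik2017]
-/

noncomputable section

open Finset
open scoped BigOperators
open Literature.MathematicalPhysics.QuantumLattice Literature.Probability.LatticeModels
  Literature.Barriers.CriticalPhenomena.NonGibbs

namespace Literature.MathematicalPhysics.QuantumLattice

variable {d : ℕ} {N b : ℕ} [NeZero N] [NeZero b]

/-! ### A unit step inside a cube -/

omit [NeZero N] [NeZero b] in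
/-- Moving one step in direction `k` inside a cube: `b c + (o + e_k) = (b c + o) + e_k` as long as
`o_k + 1 < b`. [cite: FriedliVelenik2017, §10.2] -/
theorem blockSite_update_succ (c : BlockIdx d N) (o : Fin d → Fin b) (k : Fin d)
    (h : (o k : ℕ) + 1 < b) :
    blockSite N b (c, Function.update o k ⟨(o k : ℕ) + 1, h⟩) =
      blockSite N b (c, o) + Pi.single k 1 := by
  funext i
  simp only [blockSite, Pi.add_apply]
  by_cases hi : i = k
  · subst hi
    rw [Function.update_self, Pi.single_eq_same, Fin.val_mk, Nat.cast_succ, add_assoc]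
  · rw [Function.update_of_ne hi, Pi.single_eq_of_ne hi, add_zero]

/-- **A unit step that does not cross a cube face stays in the cube**: if the `k`-th offset of `x`
is not the last one then `x + e_k` has the same block index (and the next offset).
[cite: FriedliVelenik2017, §10.2] -/
theorem blockOf_add_single_of_lt [NeZero (N * b)] (x : TorusSite d (N * b)) (k : Fin d)
    (h : (offsetOf N b x k : ℕ) + 1 < b) :
    blockOf N b (x + Pi.single k 1) = blockOf N b x := by
  have hx := blockSite_update_succ (blockOf N b x) (offsetOf N b x) k h
  rw [blockSite_blockOf_offsetOf] at hx
  rw [← hx, blockOf_blockSite]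

/-! ### Equidistribution of the offsets -/

omit [NeZero N] [NeZero b] in
/-- All fibres of `o ↦ o k` on `{0,…,b-1}^d` have the same size. [folklore] -/
private theorem card_filter_apply_eq (k : Fin d) (a a' : Fin b) :
    (univ.filter fun o : Fin d → Fin b => o k = a).card =
      (univ.filter fun o : Fin d → Fin b => o k = a').card := by
  refine Finset.card_nbij' (fun o => Function.update o k a') (fun o => Function.update o k a)
    (fun o _ => ?_) (fun o _ => ?_) (fun o ho => ?_) (fun o ho => ?_)
  · simp
  · simp
  · simp only [Finset.mem_coe, mem_filter, mem_univ, true_and] at ho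
    dsimp only
    rw [Function.update_idem, ← ho, Function.update_eq_self]
  · simp only [Finset.mem_coe, mem_filter, mem_univ, true_and] at ho
    dsimp only
    rw [Function.update_idem, ← ho, Function.update_eq_self]

omit [NeZero N] [NeZero b] in
/-- **The offsets are equidistributed in each coordinate**: `b · #{o : o k = a} = b^d` (the
offsets of the block partition of Friedli–Velenik §10.2). [cite: FriedliVelenik2017, §10.2] -/
theorem card_filter_apply_eq_mul (k : Fin d) (a : Fin b) :
    (univ.filter fun o : Fin d → Fin b => o k = a).card * b = b ^ d := by
  have htot : (univ : Finset (Fin d → Fin b)).card =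
      ∑ a' : Fin b, (univ.filter fun o : Fin d → Fin b => o k = a').card :=
    card_eq_sum_card_fiberwise (s := (univ : Finset (Fin d → Fin b))) (t := (univ : Finset (Fin b)))
      (f := fun o : Fin d → Fin b => o k) fun _ _ => mem_univ _
  rw [card_univ, Fintype.card_fun, Fintype.card_fin, Fintype.card_fin] at htot
  rw [htot, Finset.sum_congr rfl fun a' _ => card_filter_apply_eq k a' a, sum_const, card_univ,
    Fintype.card_fin, smul_eq_mul, mul_comm]

/-- **Equidistribution of the `k`-th offset over the torus**: `b · #{u : offsetOf u k = a} = |Λ|`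
(block coordinates `(ℤ/Nℤ)^d × {0,…,b-1}^d ≃ (ℤ/Nbℤ)^d`). [cite: FriedliVelenik2017, §10.2] -/
theorem card_filter_offsetOf_eq_mul [NeZero (N * b)] (k : Fin d) (a : Fin b) :
    (univ.filter fun u : TorusSite d (N * b) => offsetOf N b u k = a).card * b =
      Fintype.card (TorusSite d (N * b)) := by
  set e := chessboardBlockEquiv (d := d) N b with he
  have h1 : (univ.filter fun u : TorusSite d (N * b) => offsetOf N b u k = a).card =
      (univ.filter fun p : BlockIdx d N × (Fin d → Fin b) => p.2 k = a).card := by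
    refine Finset.card_nbij' (fun u => e.symm u) (fun p => e p) (fun u hu => ?_) (fun p hp => ?_)
      (fun u _ => Equiv.apply_symm_apply e u) (fun p _ => Equiv.symm_apply_apply e p)
    · simp only [Finset.mem_coe, mem_filter, mem_univ, true_and] at hu ⊢
      exact hu
    · simp only [Finset.mem_coe, mem_filter, mem_univ, true_and] at hp ⊢
      show ((chessboardBlockEquiv N b).symm (e p)).2 k = a
      rw [he, Equiv.symm_apply_apply]
      exact hp
  have h2 : (univ.filter fun p : BlockIdx d N × (Fin d → Fin b) => p.2 k = a) =
      (univ : Finset (BlockIdx d N)) ×ˢ (univ.filter fun o : Fin d → Fin b => o k = a) := by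
    ext p
    simp only [mem_filter, mem_univ, true_and, mem_product]
  rw [h1, h2, card_product, mul_assoc, card_filter_apply_eq_mul, card_univ, Fintype.card_pi,
    prod_const, card_univ, Fintype.card_fin, Fintype.card_pi, prod_const, card_univ,
    Fintype.card_fin, ZMod.card, ZMod.card, ← mul_pow]

/-! ### A bond is interior for most shifts -/

/-- **A nearest-neighbour bond is interior to a cube for at least the fraction `(b-1)/b` of the
shifted partitions**: `(b-1)|Λ| ≤ b · #{v : i - v and i + e_k - v lie in the same cube}`.
[cite: FrohlichLieb1978, §I.D (1.43)] -/
theorem card_filter_sameBlock_ge [NeZero (N * b)] (i : TorusSite d (N * b)) (k : Fin d) :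
    (b - 1) * Fintype.card (TorusSite d (N * b)) ≤
      b * (univ.filter fun v : TorusSite d (N * b) =>
        blockOf N b (i - v) = blockOf N b (i + Pi.single k 1 - v)).card := by
  classical
  have hb : 0 < b := Nat.pos_of_ne_zero (NeZero.ne b)
  -- the good shifts: the `k`-th offset of `i - v` is not the last one
  set good := univ.filter fun v : TorusSite d (N * b) => (offsetOf N b (i - v) k : ℕ) + 1 < b
    with hgood
  set bad := univ.filter fun v : TorusSite d (N * b) =>
    offsetOf N b (i - v) k = ⟨b - 1, Nat.sub_lt hb one_pos⟩ with hbad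
  have hsub : good ⊆ univ.filter fun v : TorusSite d (N * b) =>
      blockOf N b (i - v) = blockOf N b (i + Pi.single k 1 - v) := by
    intro v hv
    rw [mem_filter] at hv ⊢
    refine ⟨mem_univ _, ?_⟩
    rw [show i + Pi.single k 1 - v = i - v + Pi.single k 1 by abel,
      blockOf_add_single_of_lt _ _ hv.2]
  -- good and bad partition the shifts
  have hpart : good.card + bad.card = Fintype.card (TorusSite d (N * b)) := by
    have hdisj : Disjoint good bad := by
      rw [hgood, hbad, Finset.disjoint_filter]
      intro v _ h1 h2
      rw [h2] at h1
      simp only at h1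
      omega
    have hunion : good ∪ bad = univ := by
      ext v
      simp only [hgood, hbad, mem_union, mem_filter, mem_univ, true_and, iff_true]
      by_cases h : (offsetOf N b (i - v) k : ℕ) + 1 < b
      · exact Or.inl h
      · refine Or.inr (Fin.ext ?_)
        have := (offsetOf N b (i - v) k).isLt
        show (offsetOf N b (i - v) k : ℕ) = b - 1
        omega
    rw [← card_union_of_disjoint hdisj, hunion, card_univ]
  -- the bad shifts are in bijection with the sites whose `k`-th offset is the last one
  have hbadcard : bad.card * b = Fintype.card (TorusSite d (N * b)) := by
    have h := card_filter_offsetOf_eq_mul (d := d) (N := N) (b := b) k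
      ⟨b - 1, Nat.sub_lt hb one_pos⟩
    rw [← h]
    congr 1
    refine Finset.card_nbij' (fun v => i - v) (fun u => i - u) (fun v hv => ?_) (fun u hu => ?_)
      (fun v _ => sub_sub_cancel i v) (fun u _ => sub_sub_cancel i u)
    · simp only [hbad, Finset.mem_coe, mem_filter, mem_univ, true_and] at hv ⊢
      exact hv
    · simp only [hbad, Finset.mem_coe, mem_filter, mem_univ, true_and] at hu ⊢
      rwa [sub_sub_cancel]
  have hle : bad.card ≤ Fintype.card (TorusSite d (N * b)) := by rw [← hpart]; omega
  calc (b - 1) * Fintype.card (TorusSite d (N * b))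
      = b * Fintype.card (TorusSite d (N * b)) - Fintype.card (TorusSite d (N * b)) := by
        rw [Nat.sub_mul, one_mul]
    _ = b * good.card := by
        conv_lhs => rw [← hpart, mul_add, mul_comm b bad.card, hbadcard]
        omega
    _ ≤ _ := Nat.mul_le_mul_left _ (card_le_card hsub)

/-! ### Averaging over the shifts -/

variable [NeZero (N * b)]

/-- For a nearest-neighbour bond `β = (i, j)` (in either orientation) the set of shifts for which it
is interior to a cube has size `≥ (b-1)|Λ|/b`. [cite: FrohlichLieb1978, §I.D (1.43)] -/
theorem card_filter_sameBlock_ge_of_adj (β : TorusSite d (N * b) × TorusSite d (N * b))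
    (hβ : ∃ k : Fin d, β.2 = β.1 + Pi.single k 1 ∨ β.1 = β.2 + Pi.single k 1) :
    (b - 1) * Fintype.card (TorusSite d (N * b)) ≤
      b * (univ.filter fun v : TorusSite d (N * b) =>
        blockOf N b (β.1 - v) = blockOf N b (β.2 - v)).card := by
  obtain ⟨k, h | h⟩ := hβ
  · rw [h]; exact card_filter_sameBlock_ge β.1 k
  · have := card_filter_sameBlock_ge (N := N) (b := b) β.2 k
    rw [h]
    refine this.trans (Nat.mul_le_mul_left _ (card_le_card fun v hv => ?_))
    rw [mem_filter] at hv ⊢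
    exact ⟨mem_univ _, hv.2.symm⟩

/-- **Averaging over the shifts (FL (1.43))**: for every finite set of nearest-neighbour bonds of
the torus there is a shift `v` of the cube partition for which at least the fraction `(b-1)/b` of
the bonds are interior to cubes: `(b-1)·#bonds ≤ b·#{β : β interior for v}`.
[cite: FrohlichLieb1978, §I.D (1.43)] -/
theorem exists_shift_many_interior (bonds : Finset (TorusSite d (N * b) × TorusSite d (N * b)))
    (hadj : ∀ β ∈ bonds, ∃ k : Fin d, β.2 = β.1 + Pi.single k 1 ∨ β.1 = β.2 + Pi.single k 1) :
    ∃ v : TorusSite d (N * b), (b - 1) * bonds.card ≤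
      b * (bonds.filter fun β => blockOf N b (β.1 - v) = blockOf N b (β.2 - v)).card := by
  classical
  haveI : Nonempty (TorusSite d (N * b)) := ⟨fun _ => 0⟩
  have hsum : ∑ v : TorusSite d (N * b), (b - 1) * bonds.card ≤
      ∑ v : TorusSite d (N * b),
        b * (bonds.filter fun β => blockOf N b (β.1 - v) = blockOf N b (β.2 - v)).card := by
    rw [sum_const, card_univ, smul_eq_mul]
    calc Fintype.card (TorusSite d (N * b)) * ((b - 1) * bonds.card)
        = ∑ β ∈ bonds, (b - 1) * Fintype.card (TorusSite d (N * b)) := by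
          rw [sum_const, smul_eq_mul]; ring
      _ ≤ ∑ β ∈ bonds, b * (univ.filter fun v : TorusSite d (N * b) =>
            blockOf N b (β.1 - v) = blockOf N b (β.2 - v)).card :=
          sum_le_sum fun β hβ => card_filter_sameBlock_ge_of_adj β (hadj β hβ)
      _ = ∑ v : TorusSite d (N * b),
            b * (bonds.filter fun β => blockOf N b (β.1 - v) = blockOf N b (β.2 - v)).card := by
          simp only [card_filter, mul_sum]
          rw [sum_comm]
  obtain ⟨v, -, hv⟩ := exists_le_of_sum_le univ_nonempty hsum
  exact ⟨v, hv⟩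

omit [NeZero (N * b)] in
/-- The bonds interior to ONE cube of a shifted partition are few: at most `b^{2d}` ordered pairs
(a bond interior to the cube `v + c` is determined by the two offsets of its endpoints).
[cite: FrohlichLieb1978, §I.D (1.43)] -/
theorem card_filter_interior_cube_le (bonds : Finset (TorusSite d (N * b) × TorusSite d (N * b)))
    (v : TorusSite d (N * b)) (c : BlockIdx d N) :
    ((bonds.filter fun β => blockOf N b (β.1 - v) = blockOf N b (β.2 - v)).filter
        fun β => blockOf N b (β.1 - v) = c).card ≤ b ^ (2 * d) := by
  classical
  have hcard : (univ : Finset ((Fin d → Fin b) × (Fin d → Fin b))).card = b ^ (2 * d) := by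
    rw [card_univ, Fintype.card_prod, Fintype.card_fun, Fintype.card_fin, Fintype.card_fin,
      ← pow_add, two_mul]
  rw [← hcard]
  refine card_le_card_of_injOn (fun β => (offsetOf N b (β.1 - v), offsetOf N b (β.2 - v)))
    (fun β _ => mem_univ _) fun β hβ β' hβ' h => ?_
  rw [coe_filter, Set.mem_setOf_eq, mem_filter] at hβ hβ'
  simp only [Prod.mk.injEq] at h
  have h1 : β.1 - v = β'.1 - v := by
    rw [← blockSite_blockOf_offsetOf N b (β.1 - v), ← blockSite_blockOf_offsetOf N b (β'.1 - v),
      hβ.2, hβ'.2, h.1]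
  have h2 : β.2 - v = β'.2 - v := by
    rw [← blockSite_blockOf_offsetOf N b (β.2 - v), ← blockSite_blockOf_offsetOf N b (β'.2 - v),
      ← hβ.1.2, ← hβ'.1.2, hβ.2, hβ'.2, h.2]
  exact Prod.ext (sub_left_injective h1) (sub_left_injective h2)

/-- **Fröhlich–Lieb (1.43): one interior bond per cube, for a fixed fraction of the bonds.** For
every finite set of nearest-neighbour bonds of the torus `(ℤ/Nbℤ)^d` there are a shift `v`, a set
`D` of cubes of the partition `v + cubes` and a choice `sel c ∈ bonds` of a bond interior to the
cube `v + c` for each `c ∈ D`, with `(b-1)·#bonds ≤ b^{2d+1}·|D|`.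
[cite: FrohlichLieb1978, §I.D (1.43)] -/
theorem exists_shift_cube_selection
    (bonds : Finset (TorusSite d (N * b) × TorusSite d (N * b)))
    (hadj : ∀ β ∈ bonds, ∃ k : Fin d, β.2 = β.1 + Pi.single k 1 ∨ β.1 = β.2 + Pi.single k 1) :
    ∃ (v : TorusSite d (N * b)) (D : Finset (BlockIdx d N))
      (sel : BlockIdx d N → TorusSite d (N * b) × TorusSite d (N * b)),
      (∀ c ∈ D, sel c ∈ bonds ∧ blockOf N b ((sel c).1 - v) = c ∧ blockOf N b ((sel c).2 - v) = c) ∧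
      (b - 1) * bonds.card ≤ b ^ (2 * d + 1) * D.card := by
  classical
  obtain ⟨v, hv⟩ := exists_shift_many_interior bonds hadj
  set inter := bonds.filter fun β => blockOf N b (β.1 - v) = blockOf N b (β.2 - v) with hinter
  set D := inter.image fun β => blockOf N b (β.1 - v) with hD
  have hchoice : ∀ c ∈ D, ∃ β ∈ inter, blockOf N b (β.1 - v) = c := fun c hc => mem_image.1 hc
  refine ⟨v, D, fun c => if h : c ∈ D then Classical.choose (hchoice c h) else 0, ?_, ?_⟩
  · intro c hc
    obtain ⟨hmem, hc1⟩ := Classical.choose_spec (hchoice c hc)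
    simp only [dif_pos hc]
    rw [mem_filter] at hmem
    exact ⟨hmem.1, hc1, by rw [← hmem.2, hc1]⟩
  · have hfib : inter.card ≤ b ^ (2 * d) * D.card :=
      card_le_mul_card_image inter (b ^ (2 * d)) fun c _ => card_filter_interior_cube_le bonds v c
    calc (b - 1) * bonds.card ≤ b * inter.card := hv
      _ ≤ b * (b ^ (2 * d) * D.card) := Nat.mul_le_mul_left _ hfib
      _ = b ^ (2 * d + 1) * D.card := by ring

end Literature.MathematicalPhysics.QuantumLattice

end
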